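import Mathlib
import Summits.HodgeConjecture.FermatCycles.HodgeFermatThmFstarStatement

/-!
# PROPOSITION D′(3N) = THEOREM F* of DPRIME §9 IN FULL — the STATEMENT (count-neutral)

Cell `pub-hfermat` (tree path `Summits/HodgeConjecture/FermatCycles/`), seat prover-1 gen-3, acting on the
COORDINATOR KEEPER RULING of 2026-08-25 (gem sweep H1: take the off-gate kernel theorem `thmFstar` through the
normal gate, statement first).  The sibling package `run/shared/lean/pub/pub-hodgefermat/lean/HodgeFermat/` proves
THEOREM F* of its `tables/DPRIME-THEOREM.md` §9 in three forms: `DecodingFinal.thmFstar` (F* at the prime levels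
`3p`, GATE HF-G32) and `ThmFstarNFinal.thmFstar` (F*(3N): entries prime to `N`, GATE HF-G33) — both through the
gate since 2026-08-25 (`HodgeFermatThmFstar.lean`, `HodgeFermatThmFstarN.lean`, seats prover-1 gen-0 / gen-2) —
and the FULL form, PROPOSITION D′(3N) with THE DESCENT, `PropDPrimeNFinal.propDprime` / `descent` / `noCoincidence`
(module `HodgeFermat/PropDPrimeNFinal.lean`, 85 lines, sha256 `2c8127236a8cb233…`; `pub-hodgefermat/CERT.md` l.990,
GATE HF-G34; hub records `check/PropDPrimeN_link_standalone.lean` sha256 `83292861a9d8777a…` rc 0 with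
`--axioms …PropDPrimeN.propDprime` = [propext, Classical.choice, Quot.sound], `check/DecodingDPrime_part1_standalone.lean`
sha256 `e147557e91070793…` rc 0; the unconditional composition is `lake build`-only there), never put through the gate.
This file files the STATEMENT of PROPOSITION D′(3N), as a `Prop`-valued definition and nothing else; the proof — the
import closure of `PropDPrimeNFinal.propDprime` on top of the landed chains, i.e. the sibling's KR-free programme
(LEMMA O, THEOREM L with its rows at 5, 7, 11, 13 and the row `p = 3`, COROLLARY M, the DESCENT LEMMA, the level-39
enumeration `CoincFull`, THEOREM U⁼, THEOREM D6 with PROPOSITIONS L5/Z5/L7(a)/L7(c) and the digit lemma, THEOREM U via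
LEMMA W / HYPOTHESIS B / `ζ(0, x) = 1/2 − x` / HYPOTHESIS U by kernel walks and tails, THEOREM KR6, THEOREM Z3U,
LEMMA S⁺ and THEOREM U⁺) — follows in the files `HodgeFermat*.lean` of this directory, declaration bodies verbatim
from the sibling modules, ending in `theorem HodgeFermat.KRFree.PropDPrimeNFinal.propDprime3N_holds : PropDPrime3N`.

THE STATEMENT (pub-hodgefermat `tables/DPRIME-THEOREM.md` §9: «THEOREM F*: PROPOSITION D′(m) for every squarefree
m = 3m₁ with all primes of m₁ ≥ 11»).  Let `N > 0` be SQUAREFREE with all prime factors `≥ 11` and `N ≠ 13`, and let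
`T = (a, b, c)`, `T′ = (a′, b′, c′)` be triples of natural numbers with `a + b + c ≡ a′ + b′ + c′ ≡ 0 (mod 3N)`, no
entry `≡ 0 (mod 3N)`, JOINTLY PRIMITIVE (no prime `q ∣ 3N` divides all six entries) and DISJOINT mod `3N` (no entry
of `T` congruent to an entry of `T′`).  Then `T` and `T′` do not have the same CM type at level `3N`
(`H_T ∩ (ℤ/3N)ˣ ≠ H_{T′} ∩ (ℤ/3N)ˣ`, `H_T = {t : ⟨ta⟩ + ⟨tb⟩ < 3N}`; the model `HodgeFermat.KRFree.LemmaN.SameType`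
filed with the prime-level statement, `HodgeFermatThmFstarStatement.lean`, imported here, not re-declared).  Compared
with F*(3N) the entries need NOT be prime to `N` (only jointly primitive): the proof reduces a coincidence to its
primitive core by the DESCENT and classifies it with COROLLARY M (THEOREM L at every prime of `N`, THEOREM KR6 at the
levels prime to 6, THEOREM U⁺ for the all-unit case, F*(3N) for the unit-at-`N` case); the only primitive disjoint
coincidences that exist are the twelve all-unit ones of level `39 = 3·13` (THEOREM U⁼ / `CoincFull`), whence
`N ≠ 13` — and the companion theorem `PropDPrimeNFinal.descent` of the closing file says exactly that every disjoint
coincidence at a level `3N` (N squarefree, primes ≥ 11) is `g` times one of those twelve, `N = 13g`.  Context: for the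
Fermat variety of degree `m = 3N` the CM type of `(a, b, c)` is `H_T ∩ (ℤ/m)ˣ` (Koblitz–Rohrlich 1978); PROPOSITION D′
is the combinatorial input of the sibling's analysis of the Hodge gap groups `G_{3N}` (this cell's DOOR.md §0 /
RESULTS-FERMAT.md; no claim on general Hodge is made or implied here).

HONEST FRAMING: explicit algebraic cycles for specific Hodge classes on Fermat/Delsarte varieties; residual open
instances listed; no claim on general Hodge.  No `sorry`; one `Prop`-valued definition (count-neutral).
-/

set_option autoImplicit false

namespace HodgeFermat.KRFree.PropDPrimeNFinal

open HodgeFermat.KRFree.LemmaN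

/-- **PROPOSITION D′(3N) — THEOREM F\* of DPRIME §9 in full — the statement.**  For every squarefree `N > 0` all of
whose prime factors are `≥ 11`, `N ≠ 13`, and all zero-sum triples `(a, b, c)`, `(a′, b′, c′)` mod `3N` with no entry
divisible by `3N`, JOINTLY PRIMITIVE (no prime `q ∣ 3N` divides all six entries) and DISJOINT mod `3N`, the two
triples do not have the same CM type at level `3N` (`LemmaN.SameType (3N)`).  This is LITERALLY the universal closure
of the signature of the sibling package's `HodgeFermat.KRFree.PropDPrimeNFinal.propDprime` (`PropDPrimeNFinal.lean:44`);
proved in `HodgeFermatPropDPrimeNFinal.lean` as `propDprime3N_holds`.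
(pub-hodgefermat `tables/DPRIME-THEOREM.md` §9; CERT.md l.990, GATE HF-G34.) -/
def PropDPrime3N : Prop :=
  ∀ ⦃N : ℕ⦄, 0 < N → Squarefree N → (∀ p ∈ N.primeFactors, 11 ≤ p) → N ≠ 13 → ∀ ⦃a b c a' b' c' : ℕ⦄,
    3 * N ∣ a + b + c → ¬ 3 * N ∣ a → ¬ 3 * N ∣ b → ¬ 3 * N ∣ c →
    3 * N ∣ a' + b' + c' → ¬ 3 * N ∣ a' → ¬ 3 * N ∣ b' → ¬ 3 * N ∣ c' →
    (∀ q, Nat.Prime q → q ∣ 3 * N → q ∣ a → q ∣ b → q ∣ c → q ∣ a' → q ∣ b' → q ∣ c' → False) →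
    (∀ u v, (u = a ∨ u = b ∨ u = c) → (v = a' ∨ v = b' ∨ v = c') → ¬ u ≡ v [MOD 3 * N]) →
    ¬ SameType (3 * N) (a, b, c) (a', b', c')

end HodgeFermat.KRFree.PropDPrimeNFinal
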